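import Summits.HubbardSuperconductivity.HubbardSuperconductivity.Theses.AposterioriCapRg
import Summits.HubbardSuperconductivity.HubbardSuperconductivity.Theorems.AposterioriCapRgCapRgSymmetricCertificatePinnedStubCooperC4v
import Summits.HubbardSuperconductivity.HubbardSuperconductivity.Theorems.AposterioriCapRgCapRgSymmetricCertificatePinnedStubDominanceOfMargins
import Summits.HubbardSuperconductivity.HubbardSuperconductivity.Theorems.AposterioriCapRgCapRgSymmetricCertificatePinnedStubB1gReadout
import Summits.HubbardSuperconductivity.HubbardSuperconductivity.Theorems.AposterioriCapRgCapRgSymmetricCertificatePinnedStubLadderMono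
import Literature.MathematicalPhysics.QuantumLattice.RayleighBottom
import Literature.MathematicalPhysics.QuantumLattice.HubbardGrandCanonicalDensity
import Summits.HubbardSuperconductivity.HubbardSuperconductivity.Theorems.WeakCouplingBCSWcbcsBcsConstructionEnergyDensityLimit

/-!
# Line `loewner-riccati-channel-sandwich` for crux `CapRgSymmetricCertificatePinned`
# (item stmt-HubbardSuperconductivity-14045, route AposterioriCapRg) — the lead's skeleton (seat 2), v4

Lead: prover-line-stmt-HubbardSuperconductivity-14045-1 (second lead seat; the first seat drove
`strict-continuum-certificate-transfer` to its engine stub C⁺′, `Lines/strict_continuum_certificate_transfer.lean`).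
The planner's skeleton of this line (evidence `line-loewner-riccati-channel-sandwich.lean`, stubs 81290/81407/81408/81409)
is not readable from a lead's jail and was never published under `Cruxes/…/Lines/`; this file REBUILDS the line from the
tree-readable sources: the idea card `Ideas/loewner-riccati-channel-sandwich.md`, the ideator's checked sketch
`SketchIdeator2.lean` (`ladderStep`, `ladderStep_mono`, `sandwich_step`, `rayleigh_sandwich`), the archived stub
signatures, the LANDED glue of the first seat (`stub_cooperC4v` p89297 = this line's `stub_c4vCovariance` verbatim;
`stub_dominanceOfMargins` p85399 = the engine of this line's read-out) and the strict-continuum v3 outer glue.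

Composition idea (card): the two SPECTRAL clauses of the certificate — (ii′) Cooper dominance, (iii′) the window
`λ_d ∈ [a, b]` — are read off a two-sided LOEWNER SANDWICH `X⁻ ≤ H(A) ≤ X⁺` of the Hermitian part of the Cooper matrix
`A`, and the sandwich is the output of a DISCRETE LADDER-COMPARISON CERTIFICATE: along a scale grid the Hermitian
channel operator obeys `X_{j+1} = Φ_{R_j}(X_j) + F_j` with the one-step Bethe–Salpeter map `Φ_R(X) = X(1 + RX)⁻¹`
(slice pair bubble `R_j = S_j² ≥ 0`) and a non-ladder feed `F_j` bracketed in Loewner order, `F⁻_j ≤ F_j ≤ F⁺_j`;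
two point-valued comparison recursions `X^∓` validated as sub/super-solutions then enclose `X_N = H(A)` because `Φ_R`
is LOEWNER-MONOTONE on the pole-free domain (`stub_ladderMono`, the line's first obligation) — `ladderCert_sandwich`,
proved here by induction; the read-out `stub_b1gReadout` (sandwich + `D₄` covariance + four finite checks on `X^∓_N`
⇒ `CooperDominance A ∧ a ≤ λ_d ≤ b`) feeds the strict-continuum composition verbatim (`exists_window_of_mem_Ioo`,
`block_of_eventually`, strict margins ⇒ clauses).  The remaining stub `stub_certifiedTrajectory` is the ENGINE: the
per-accuracy certificate C⁺′ of the first seat with its Cooper clauses (G)/(H4)/window REPLACED by the existence,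
eventually along `M → ∞`, `β → ∞`, `L → ∞`, of a discrete ladder-comparison certificate whose final checks certify
`λ_d` to precision `η` around a limit value `lam ∈ (1/8, 1/5)` (crux-sized: constructive RG at `U ∈ [2,3]` + the
density conjunct; Disproof.lean A3/A8/A10/A11).

`CapRgSymmetricCertificatePinned_of` concludes the crux BY NAME; v3: `stub_b1gReadout` LANDED (p96323) and `stub_ladderMono` LANDED
(p96375), both imported — the comparison theorem `LadderCert.sandwich` and the read-out `cooper_of_cert` are CLOSED; v4 (this file):
the DENSITY CONJUNCT of the engine stub is factored through Griffiths' lemma — the grand-canonical energy-density limit EXISTS in the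
tree (`stub_torusGcEnergyDensityLimit`, landed for crux WcbcsBcsConstruction) and `tendsto_gcDensity_of_hasDerivAt`
(HubbardGrandCanonicalDensity.lean) turns differentiability of that limit at `μ` with slope `δ − 1` into the density clause; so the
engine now asks for the REGULAR EQUATION OF STATE at the point (the open part) instead of the raw limit.  The only `sorry` is
`stub_certifiedTrajectory` (the engine).
-/

noncomputable section

namespace Summit.HubbardSuperconductivity.CapRgSymmetricCertificatePinned.Loewner

open Filter Topology
open Literature.MathematicalPhysics.QuantumLattice Literature.Probability.LatticeModels Matrix
open Summit.HubbardSuperconductivity.CapRgSymmetricCertificatePinned.StrictContinuum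
  (stub_cooperC4v stub_dominanceOfMargins)
open scoped BigOperators ComplexOrder

/-! ## §1 The ladder step and the registered glue stubs -/

section Ladder

variable {n : Type*} [Fintype n] [DecidableEq n]

/-- The one-step ladder (Bethe–Salpeter) map with slice pair bubble `R ≥ 0`: `Φ_R(X) = X (1 + R X)⁻¹`
(`SketchIdeator2.ladderStep`; for a scalar bubble `R = b·1` it is `x ↦ x/(1 + b x)`). -/
def ladderStep (R X : Matrix n n ℂ) : Matrix n n ℂ := X * (1 + R * X)⁻¹

/- Stub `stub_ladderMono` (Loewner monotonicity of the Bethe–Salpeter step `X ↦ X(1+RX)⁻¹` on the pole-free domain):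
   LANDED p96375 as `Theorems/AposterioriCapRgCapRgSymmetricCertificatePinnedStubLadderMono.lean` (imported above; same namespace,
   same name; proof by Woodbury + Schur complement `Matrix.PosDef.fromBlocks₁₁`, limit-free, valid for singular `S`). -/

end Ladder

/- Stub `stub_b1gReadout` (read-out of `CooperDominance` and the window from a Rayleigh sandwich + four finite checks):
   LANDED p96323 as `Theorems/AposterioriCapRgCapRgSymmetricCertificatePinnedStubB1gReadout.lean` (imported above; same
   namespace, same name `stub_b1gReadout`). -/

/-! ## §2 The discrete ladder-comparison certificate and the sandwich theorem (proved from `stub_ladderMono`) -/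

section Cert

variable {n : Type*} [Fintype n] [DecidableEq n]

/-- The Hermitian part `H(A) = ½ (A + Aᴴ)` of a complex matrix (its real Rayleigh quotient is that of `A`,
`reRayleigh_hermPart`). -/
def hermPart (A : Matrix n n ℂ) : Matrix n n ℂ := (2 : ℂ)⁻¹ • (A + Aᴴ)

omit [Fintype n] [DecidableEq n] in
/-- The Hermitian part is Hermitian. -/
theorem hermPart_isHermitian (A : Matrix n n ℂ) : (hermPart A).IsHermitian := by
  unfold hermPart
  have h2 : star ((2 : ℂ)⁻¹) = (2 : ℂ)⁻¹ := by simp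
  rw [IsHermitian, conjTranspose_smul, h2, conjTranspose_add, conjTranspose_conjTranspose, add_comm]

omit [DecidableEq n] in
/-- `⟨v, Aᴴ v⟩ = conj ⟨v, A v⟩`. -/
theorem star_dotProduct_conjTranspose_mulVec (A : Matrix n n ℂ) (v : n → ℂ) :
    star v ⬝ᵥ (Aᴴ *ᵥ v) = star (star v ⬝ᵥ (A *ᵥ v)) := by
  rw [RayleighBottom.star_dotProduct_mulVec_eq, conjTranspose_conjTranspose, ← star_dotProduct_star, star_star]

omit [DecidableEq n] in
/-- **The real Rayleigh quotient of the Hermitian part is that of the matrix.** -/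
theorem reRayleigh_hermPart (A : Matrix n n ℂ) (v : n → ℂ) : reRayleigh (hermPart A) v = reRayleigh A v := by
  unfold reRayleigh hermPart
  rw [smul_mulVec, dotProduct_smul, add_mulVec, dotProduct_add, star_dotProduct_conjTranspose_mulVec,
    smul_eq_mul, Complex.mul_re, Complex.add_re, Complex.add_im, Complex.star_def, Complex.conj_re,
    Complex.conj_im]
  norm_num
  ring

omit [Fintype n] [DecidableEq n] in
/-- Loewner order is transitive: `A ≤ B ≤ C ⇒ A ≤ C`. -/
theorem posSemidef_sub_trans {A B C : Matrix n n ℂ} (h₁ : (B - A).PosSemidef) (h₂ : (C - B).PosSemidef) :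
    (C - A).PosSemidef := by
  simpa [sub_add_sub_cancel'] using h₁.add h₂

omit [DecidableEq n] in
/-- **Rayleigh sandwich** (`SketchIdeator2.rayleigh_sandwich`): `Xm ≤ X ≤ Xp` in Loewner order bounds every real
Rayleigh quotient of `X` between those of `Xm` and `Xp`. -/
theorem rayleigh_sandwich {X Xm Xp : Matrix n n ℂ} (hlo : (X - Xm).PosSemidef) (hhi : (Xp - X).PosSemidef)
    (v : n → ℂ) : reRayleigh Xm v ≤ reRayleigh X v ∧ reRayleigh X v ≤ reRayleigh Xp v := by
  constructor
  · have h := hlo.dotProduct_mulVec_nonneg v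
    rw [Matrix.sub_mulVec, dotProduct_sub] at h
    have h' := (Complex.le_def.1 h).1
    simp only [Complex.zero_re, Complex.sub_re] at h'
    unfold reRayleigh
    linarith
  · have h := hhi.dotProduct_mulVec_nonneg v
    rw [Matrix.sub_mulVec, dotProduct_sub] at h
    have h' := (Complex.le_def.1 h).1
    simp only [Complex.zero_re, Complex.sub_re] at h'
    unfold reRayleigh
    linarith

/-- Pole-freeness propagates UP the Loewner order: `Xm ≤ X`, `S ≥ 0`, `1 + S Xm S > 0 ⇒ 1 + S X S > 0`. -/
theorem posDef_one_add_conj_of_le {S Xm X : Matrix n n ℂ} (hS : S.PosSemidef) (hle : (X - Xm).PosSemidef)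
    (hd : (1 + S * Xm * S).PosDef) : (1 + S * X * S).PosDef := by
  have hcongr : (S * (X - Xm) * S).PosSemidef := by
    simpa [hS.1.eq] using hle.conjTranspose_mul_mul_same S
  have : 1 + S * X * S = (1 + S * Xm * S) + S * (X - Xm) * S := by
    simp only [Matrix.mul_sub, Matrix.sub_mul]; abel
  rw [this]
  exact hd.add_posSemidef hcongr

/-- **One sandwich step** (`SketchIdeator2.sandwich_step`, from `stub_ladderMono`): a flow step `X' = Φ_R(X) + F` with
bracketed feed `Fm ≤ F ≤ Fp` and comparison matrices `Xm ≤ X ≤ Xp`, all three pole-free, gives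
`Φ_R(Xm) + Fm ≤ X' ≤ Φ_R(Xp) + Fp`. -/
theorem sandwich_step (R S X Xm Xp F Fm Fp : Matrix n n ℂ) (hR : R.PosSemidef) (hS : S.PosSemidef)
    (hSR : S * S = R) (hX : X.IsHermitian) (hXm : Xm.IsHermitian) (hXp : Xp.IsHermitian)
    (hlo : (X - Xm).PosSemidef) (hhi : (Xp - X).PosSemidef)
    (hFlo : (F - Fm).PosSemidef) (hFhi : (Fp - F).PosSemidef)
    (hdm : (1 + S * Xm * S).PosDef) (hd : (1 + S * X * S).PosDef) (hdp : (1 + S * Xp * S).PosDef) :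
    (ladderStep R X + F - (ladderStep R Xm + Fm)).PosSemidef ∧
      (ladderStep R Xp + Fp - (ladderStep R X + F)).PosSemidef := by
  constructor
  · have h1 := stub_ladderMono R S Xm X hR hS hSR hXm hX hlo hdm hd
    simpa [ladderStep, add_sub_add_comm] using h1.add hFlo
  · have h1 := stub_ladderMono R S X Xp hR hS hSR hX hXp hhi hd hdp
    simpa [ladderStep, add_sub_add_comm] using h1.add hFhi

/-- **A discrete `N`-step ladder-comparison certificate for the target matrix `T`** (the card's C⁺(L,β,M), Cooper half):
a scale grid `j = 0, …, N`; slice pair bubbles `R_j = S_j²`, `S_j ≥ 0`; the TRUE Hermitian channel operators `X_j` with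
`X_N = T`, obeying the flow `X_{j+1} = Φ_{R_j}(X_j) + F_j`; Loewner brackets `F⁻_j ≤ F_j ≤ F⁺_j` of the non-ladder feed;
point-valued comparison data `X⁻_j`, `X⁺_j` validated as SUB/SUPER-solutions (`X⁻_{j+1} ≤ Φ(X⁻_j) + F⁻_j`,
`X⁺_{j+1} ≥ Φ(X⁺_j) + F⁺_j`), sandwiching the initial datum, with the LOWER comparison flow pole-free (pole-freeness of
`X_j`, `X⁺_j` then follows, `posDef_one_add_conj_of_le`). -/
structure LadderCert (N : ℕ) (T : Matrix n n ℂ) where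
  /-- slice pair bubbles `R_j ≥ 0` -/
  R : Fin N → Matrix n n ℂ
  /-- their positive square roots `S_j`, `S_j² = R_j` -/
  S : Fin N → Matrix n n ℂ
  /-- the true non-ladder feed `F_j` -/
  F : Fin N → Matrix n n ℂ
  /-- lower feed bracket `F⁻_j` -/
  Fm : Fin N → Matrix n n ℂ
  /-- upper feed bracket `F⁺_j` -/
  Fp : Fin N → Matrix n n ℂ
  /-- the true Hermitian channel operators `X_j` -/
  X : Fin (N + 1) → Matrix n n ℂ
  /-- lower comparison flow `X⁻_j` -/
  Xm : Fin (N + 1) → Matrix n n ℂ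
  /-- upper comparison flow `X⁺_j` -/
  Xp : Fin (N + 1) → Matrix n n ℂ
  R_psd : ∀ j, (R j).PosSemidef
  S_psd : ∀ j, (S j).PosSemidef
  S_sq : ∀ j, S j * S j = R j
  X_herm : ∀ j, (X j).IsHermitian
  Xm_herm : ∀ j, (Xm j).IsHermitian
  Xp_herm : ∀ j, (Xp j).IsHermitian
  lo_zero : (X 0 - Xm 0).PosSemidef
  hi_zero : (Xp 0 - X 0).PosSemidef
  step : ∀ j : Fin N, X j.succ = ladderStep (R j) (X j.castSucc) + F j
  F_lo : ∀ j, (F j - Fm j).PosSemidef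
  F_hi : ∀ j, (Fp j - F j).PosSemidef
  Xm_step : ∀ j : Fin N, (ladderStep (R j) (Xm j.castSucc) + Fm j - Xm j.succ).PosSemidef
  Xp_step : ∀ j : Fin N, (Xp j.succ - (ladderStep (R j) (Xp j.castSucc) + Fp j)).PosSemidef
  pole_m : ∀ j : Fin N, (1 + S j * Xm j.castSucc * S j).PosDef
  target : X (Fin.last N) = T

/-- **The comparison theorem** (the card's ENCLOSURE THEOREM, discrete form): along a ladder-comparison certificate the
true trajectory stays sandwiched, `X⁻_j ≤ X_j ≤ X⁺_j` for every `j` — induction over `sandwich_step`, the pole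
conditions of `X_j`, `X⁺_j` being inherited from `X⁻_j`. -/
theorem LadderCert.sandwich_all {N : ℕ} {T : Matrix n n ℂ} (c : LadderCert N T) :
    ∀ j : Fin (N + 1), (c.X j - c.Xm j).PosSemidef ∧ (c.Xp j - c.X j).PosSemidef := by
  intro j
  induction j using Fin.induction with
  | zero => exact ⟨c.lo_zero, c.hi_zero⟩
  | succ j ih =>
    obtain ⟨hlo, hhi⟩ := ih
    have hd : (1 + c.S j * c.X j.castSucc * c.S j).PosDef := posDef_one_add_conj_of_le (c.S_psd j) hlo (c.pole_m j)
    have hdp : (1 + c.S j * c.Xp j.castSucc * c.S j).PosDef := posDef_one_add_conj_of_le (c.S_psd j) hhi hd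
    obtain ⟨h1, h2⟩ := sandwich_step (c.R j) (c.S j) (c.X j.castSucc) (c.Xm j.castSucc) (c.Xp j.castSucc) (c.F j)
      (c.Fm j) (c.Fp j) (c.R_psd j) (c.S_psd j) (c.S_sq j) (c.X_herm _) (c.Xm_herm _) (c.Xp_herm _) hlo hhi
      (c.F_lo j) (c.F_hi j) (c.pole_m j) hd hdp
    refine ⟨?_, ?_⟩
    · rw [c.step j]
      exact posSemidef_sub_trans (c.Xm_step j) h1
    · rw [c.step j]
      exact posSemidef_sub_trans h2 (c.Xp_step j)

/-- **The sandwich at the target**: `X⁻_N ≤ T ≤ X⁺_N`, hence every real Rayleigh quotient of `T` is enclosed. -/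
theorem LadderCert.sandwich {N : ℕ} {T : Matrix n n ℂ} (c : LadderCert N T) :
    (T - c.Xm (Fin.last N)).PosSemidef ∧ (c.Xp (Fin.last N) - T).PosSemidef := by
  have h := c.sandwich_all (Fin.last N)
  rwa [c.target] at h

end Cert

/-- **The final checks of a Cooper-channel comparison certificate** at thresholds `(a, b)`: on the endpoint comparison
matrices `Xm`, `Xp` of the torus of side `L` — (C1) a `B₁g` unit vector with `q_{Xp} ≤ -a`; (C2) `q_{Xm} ≥ -b` on unit
vectors; (C3) a strict isotypic gap `q_{Xm} ≥ m > -a` off `B₁g`; (C4) a unit `f₁` off which `q_{Xm} ≥ -a/2`.  Finitely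
many scalar inequalities between comparison eigen-data (the card's point 4). -/
def FinalChecks (L : ℕ) [NeZero L] (a b : ℝ) (Xm Xp : Matrix (TorusSite 2 L) (TorusSite 2 L) ℂ) : Prop :=
  (∃ f : TorusSite 2 L → ℂ, star f ⬝ᵥ f = 1 ∧ IsB1g f ∧ reRayleigh Xp f ≤ -a) ∧
  (∀ g : TorusSite 2 L → ℂ, star g ⬝ᵥ g = 1 → -b ≤ reRayleigh Xm g) ∧
  (∃ m : ℝ, -a < m ∧ ∀ g : TorusSite 2 L → ℂ, star g ⬝ᵥ g = 1 →
    (∀ f : TorusSite 2 L → ℂ, IsB1g f → star f ⬝ᵥ g = 0) → m ≤ reRayleigh Xm g) ∧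
  (∃ f₁ : TorusSite 2 L → ℂ, star f₁ ⬝ᵥ f₁ = 1 ∧
    ∀ g : TorusSite 2 L → ℂ, star g ⬝ᵥ g = 1 → star f₁ ⬝ᵥ g = 0 → -a / 2 ≤ reRayleigh Xm g)

/-- **Read-out of a certified Cooper matrix**: a ladder-comparison certificate for `H(A)` with final checks at `(a, b)`,
`a > 0`, and `D₄` covariance of `A` give `CooperDominance A ∧ a ≤ λ_d(A) ≤ b` (`LadderCert.sandwich` +
`reRayleigh_hermPart` + `stub_b1gReadout`). -/
theorem cooper_of_cert {L : ℕ} [NeZero L] {A : Matrix (TorusSite 2 L) (TorusSite 2 L) ℂ} {a b : ℝ} (ha : 0 < a)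
    (hcov : ∀ (γ : DihedralGroup 4) (k k' : TorusSite 2 L), A (d4Site γ k) (d4Site γ k') = A k k')
    {N : ℕ} (c : LadderCert N (hermPart A)) (hchk : FinalChecks L a b (c.Xm (Fin.last N)) (c.Xp (Fin.last N))) :
    CooperDominance A ∧ a ≤ (-A).supRayleigh ∧ (-A).supRayleigh ≤ b := by
  obtain ⟨hC1, hC2, ⟨m, hm, hC3⟩, hC4⟩ := hchk
  have hsand := c.sandwich
  have hlo : ∀ g, reRayleigh (c.Xm (Fin.last N)) g ≤ reRayleigh A g := fun g => by
    rw [← reRayleigh_hermPart A g]; exact (rayleigh_sandwich hsand.1 hsand.2 g).1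
  have hhi : ∀ g, reRayleigh A g ≤ reRayleigh (c.Xp (Fin.last N)) g := fun g => by
    rw [← reRayleigh_hermPart A g]; exact (rayleigh_sandwich hsand.1 hsand.2 g).2
  exact stub_b1gReadout L A _ _ a b m ha hm hcov hlo hhi hC1 hC2 hC3 hC4

/-! ## §3 The engine stub (HARDEST; the lead's) -/

/-- **Stub `stub_certifiedTrajectory`** (the ENGINE; crux-sized): at some point `(U, δ, μ)` of the box where the limiting
grand-canonical ground-state energy density `g_U(ν) = lim_L E₀(hubbardTorusWith 2 (L+1) 1 U ν)/(L+1)²` (it exists: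
`stub_torusGcEnergyDensityLimit`, tree) is DIFFERENTIABLE at `μ` with slope `δ − 1` (regular equation of state at density `1 − δ`;
Griffiths' lemma `tendsto_gcDensity_of_hasDerivAt` then gives the density clause), FOR EVERY mismatch tolerance `c > 0` there are an admissible frame `K` and an admissible scale `Λ` with the pinned
shell geometry such that, eventually along `M → ∞`, then `β → ∞`, then `L → ∞` (torus side `L + 1`, `2(M + 1)`
frequencies): the Fermi-curve mismatch is `< c + ½|e_K|` on the shell; the non-spectral clauses hold STRICTLY (normaliser
`≠ 0`, field strengths in `(ζ, 1/ζ)`, `‖𝒱₄‖_∞ < E₁`, truncated remainder `< E₃`) and the Stoner products are `< 1 − σ`;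
and the COOPER CHANNEL IS CERTIFIED BY COMPARISON: for a limit value `lam ∈ (1/8, 1/5)` and every precision `η > 0`,
eventually, a discrete ladder-comparison certificate for the Hermitian part of the Cooper matrix whose final checks hold
at thresholds `(lam − η, lam + η)`.  (The first seat's C⁺′ with (G)/(H4)/window routed through the sandwich; the analytic
content — ladders solved exactly, non-ladder feed bracketed scale by scale, uniformly in `(L, β, M)` — is constructive
RG at `U ∈ [2,3]`, no printed radius: Disproof.lean A3/A8/A10/A11.) -/
theorem stub_certifiedTrajectory :
    ∃ U ∈ Set.Icc (2:ℝ) 3, ∃ δ ∈ Set.Icc (1/5:ℝ) (7/20), ∃ μ : ℝ,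
      HasDerivAt (fun ν : ℝ => limUnder atTop (fun L : ℕ =>
        (hubbardTorusWith 2 (L + 1) 1 U ν).groundEnergy / ((L + 1 : ℕ) : ℝ) ^ 2)) (δ - 1) μ ∧
      ∀ c : ℝ, 0 < c → ∃ (K : TrigPolyC4v) (Λ : ℝ),
        capRgCornerDataT.AdmitsFrameNorm (K.coeffNorm capRgCornerDataT.frameDecay) ∧
        capRgCornerDataT.AdmitsScale Λ ∧
        ShellGeometry (renormalisedBandC μ K) Λ capRgCornerDataT.velLower capRgCornerDataT.velUpper
          capRgCornerDataT.curvLower capRgCornerDataT.curvUpper capRgCornerDataT.vanHoveDist ∧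
        (∀ᶠ L : ℕ in atTop, ∀ᶠ β : ℝ in atTop, ∀ᶠ M : ℕ in atTop,
          ∀ k ∈ momentumShell (L + 1) (nambuXiCT (L + 1) μ K) Λ, ∀ σ : Fin 2,
            |(selfEnergy (L + 1) (M + 1) β (hubbardEffectiveActionCT (L + 1) (M + 1) β U μ 0 K Λ)
                (omega0 (M + 1), k) σ).re| <
              c + capRgCornerDataT.slopeAllowance * |nambuXiCT (L + 1) μ K k|) ∧
        (∀ᶠ L : ℕ in atTop, ∀ᶠ β : ℝ in atTop, ∀ᶠ M : ℕ in atTop,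
          hubbardEffPartitionFnCT (L + 1) (M + 1) β U μ 0 K Λ ≠ 0 ∧
          (∀ k ∈ momentumShell (L + 1) (nambuXiCT (L + 1) μ K) Λ, ∀ σ : Fin 2,
            (capRgCornerDataT.fieldFloor : ℝ) <
                fieldStrengthSpin (L + 1) (M + 1) β (hubbardEffectiveActionCT (L + 1) (M + 1) β U μ 0 K Λ) k σ ∧
              fieldStrengthSpin (L + 1) (M + 1) β (hubbardEffectiveActionCT (L + 1) (M + 1) β U μ 0 K Λ) k σ <
                1 / capRgCornerDataT.fieldFloor) ∧
          vertexSupNorm (L + 1) (M + 1) β (hubbardEffectiveActionCT (L + 1) (M + 1) β U μ 0 K Λ) 4 <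
            capRgCornerDataT.quarticBound ∧
          remainderWeightNormUpTo (L + 1) (M + 1) capRgCornerDataT.remainderDegree β
              ((capRgCornerDataT.fieldRadius : ℝ) ^ 2 * Λ)
              (hubbardEffectiveActionCT (L + 1) (M + 1) β U μ 0 K Λ) < capRgCornerDataT.remainderBound ∧
          (∀ q : TorusSite 2 (L + 1),
            stonerCharge (L + 1) (M + 1) β (nambuXiCT (L + 1) μ K) Λ
                (hubbardEffectiveActionCT (L + 1) (M + 1) β U μ 0 K Λ) q < 1 - capRgCornerDataT.stonerMargin ∧
              stonerSpin (L + 1) (M + 1) β (nambuXiCT (L + 1) μ K) Λ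
                (hubbardEffectiveActionCT (L + 1) (M + 1) β U μ 0 K Λ) q < 1 - capRgCornerDataT.stonerMargin)) ∧
        (∃ lam : ℝ, ((symmetricWindowLower : ℝ) < lam ∧ lam < symmetricWindowUpper) ∧
          ∀ η : ℝ, 0 < η → ∀ᶠ L : ℕ in atTop, ∀ᶠ β : ℝ in atTop, ∀ᶠ M : ℕ in atTop,
            ∃ (N : ℕ) (cert : LadderCert N (hermPart (cooperMatrix (L + 1) (M + 1) β (nambuXiCT (L + 1) μ K) Λ
                (hubbardEffectiveActionCT (L + 1) (M + 1) β U μ 0 K Λ)))),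
              FinalChecks (L + 1) (lam - η) (lam + η) (cert.Xm (Fin.last N)) (cert.Xp (Fin.last N))) := by
  sorry

/-! ## §4 Outer glue (verbatim from the first seat's v3 skeleton) -/

/-- **An interior window value has rational enclosures of every width**: for `x ∈ (1/8, 1/5)` and a rational `w > 0`
there are rationals `1/8 ≤ a < x < b ≤ 1/5` with `b - a ≤ w`. -/
theorem exists_window_of_mem_Ioo {x : ℝ} (hlo : (symmetricWindowLower : ℝ) < x)
    (hhi : x < symmetricWindowUpper) {w : ℚ} (hw : 0 < w) :
    ∃ a b : ℚ, symmetricWindowLower ≤ a ∧ a ≤ b ∧ b ≤ symmetricWindowUpper ∧ b - a ≤ w ∧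
      (a : ℝ) < x ∧ x < b := by
  have hw' : (0 : ℝ) < w := by exact_mod_cast hw
  obtain ⟨a, ha1, ha2⟩ := exists_rat_btwn (max_lt hlo (show x - w / 2 < x by linarith))
  obtain ⟨b, hb1, hb2⟩ := exists_rat_btwn (lt_min hhi (show x < x + w / 2 by linarith))
  have ha1' : ((symmetricWindowLower : ℚ) : ℝ) < a := lt_of_le_of_lt (le_max_left _ _) ha1
  have ha1'' : x - w / 2 < a := lt_of_le_of_lt (le_max_right _ _) ha1
  have hb2' : (b : ℝ) < symmetricWindowUpper := lt_of_lt_of_le hb2 (min_le_left _ _)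
  have hb2'' : (b : ℝ) < x + w / 2 := lt_of_lt_of_le hb2 (min_le_right _ _)
  refine ⟨a, b, ?_, ?_, ?_, ?_, ha2, hb1⟩
  · exact_mod_cast ha1'.le
  · exact_mod_cast (ha2.trans hb1).le
  · exact_mod_cast hb2'.le
  · have : (b : ℝ) - a ≤ w := by linarith
    exact_mod_cast this

/-- Filter bookkeeping: an `atTop`-eventual property of `L + 1`, `β`, `M + 1` yields the crux's
`∃ L₀ ∀ L ≥ L₀ [NeZero L] ∃ β₀ ∀ β ≥ β₀ ∃ M₀ ∀ M ≥ M₀ [NeZero M]` block. -/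
theorem block_of_eventually {P : ∀ (L : ℕ) [NeZero L], ℝ → ∀ (M : ℕ) [NeZero M], Prop}
    (h : ∀ᶠ L : ℕ in atTop, ∀ᶠ β : ℝ in atTop, ∀ᶠ M : ℕ in atTop, P (L + 1) β (M + 1)) :
    ∃ L₀ : ℕ, ∀ L : ℕ, L₀ ≤ L → ∀ [NeZero L], ∃ β₀ : ℝ, ∀ β : ℝ, β₀ ≤ β →
      ∃ M₀ : ℕ, ∀ M : ℕ, M₀ ≤ M → ∀ [NeZero M], P L β M := by
  obtain ⟨L₀, hL₀⟩ := eventually_atTop.1 h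
  refine ⟨L₀ + 1, fun L hL _ => ?_⟩
  obtain ⟨L', rfl⟩ : ∃ L', L = L' + 1 := ⟨L - 1, by omega⟩
  obtain ⟨β₀, hβ₀⟩ := eventually_atTop.1 (hL₀ L' (by omega))
  refine ⟨β₀, fun β hβ => ?_⟩
  obtain ⟨M₀, hM₀⟩ := eventually_atTop.1 (hβ₀ β hβ)
  refine ⟨M₀ + 1, fun M hM _ => ?_⟩
  obtain ⟨M', rfl⟩ : ∃ M', M = M' + 1 := ⟨M - 1, by omega⟩
  exact hM₀ M' (by omega)

/-! ## §5 The composition: the engine stub ⇒ the crux, by name -/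

/-- **The line closes the crux modulo its stubs**: `stub_certifiedTrajectory` implies `CapRgSymmetricCertificatePinned` —
given `Θ = (c₀, w)` take `c := c₀ · Λ₁` (`Λ₁ = 1/100 ≤ Λ`), the frame and scale the engine provides, a rational enclosure
`[a, b] ∋ lam` of width `≤ w`, the precision `η := min (lam − a) (b − lam)`; eventually in `(L, β, M)` the comparison
certificate and its final checks give `CooperDominance` and `a ≤ λ_d ≤ b` (`cooper_of_cert`: `stub_ladderMono`,
`stub_b1gReadout`, landed `stub_cooperC4v`), strict margins give the non-strict clauses, and `block_of_eventually`
produces `L₀`, `β₀(L)`, `M₀(L, β)`. -/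
theorem CapRgSymmetricCertificatePinned_of :
    Summit.HubbardSuperconductivity.HubbardSuperconductivity.Theses.AposterioriCapRg.CapRgSymmetricCertificatePinned := by
  obtain ⟨U, hU, δ, hδ, μ, hder, hacc⟩ := stub_certifiedTrajectory
  -- the density clause from the regular equation of state: the GC energy-density limit exists (tree) + Griffiths' lemma (tree)
  have hlim : ∀ ν : ℝ, Tendsto (fun L : ℕ => (hubbardTorusWith 2 (L + 1) 1 U ν).groundEnergy / ((L + 1 : ℕ) : ℝ) ^ 2)
      atTop (𝓝 ((fun ν : ℝ => limUnder atTop (fun L : ℕ =>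
        (hubbardTorusWith 2 (L + 1) 1 U ν).groundEnergy / ((L + 1 : ℕ) : ℝ) ^ 2)) ν)) := fun ν =>
    tendsto_nhds_limUnder (Summit.HubbardSuperconductivity.HubbardSuperconductivity.Theorems.stub_torusGcEnergyDensityLimit U ν)
  have hdens : Tendsto (fun L : ℕ => ((hubbardTorusWith 2 (L + 1) 1 U μ).groundStateFunctional totalNumber).re /
      ((L + 1 : ℕ) : ℝ) ^ 2) atTop (𝓝 (1 - δ)) := by
    have h := tendsto_gcDensity_of_hasDerivAt 1 U μ (Eventually.of_forall hlim) hder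
    rwa [neg_sub] at h
  refine ⟨U, hU, δ, hδ, μ, hdens, fun Θ => ?_⟩
  -- the mismatch tolerance handed to the engine: `c := c₀ · Λ₁ ≤ c₀ · Λ`
  have hc : (0 : ℝ) < Θ.mismatch * capRgCornerDataT.scaleLower :=
    mul_pos (by exact_mod_cast Θ.mismatch_pos) (by exact_mod_cast capRgCornerDataT.scaleLower_pos)
  obtain ⟨K, Λ, hframe, hΛ, hgeom, hmis, hblock, ⟨lam, ⟨hlo, hhi⟩, hcert⟩⟩ := hacc _ hc
  have hcΛ : (Θ.mismatch : ℝ) * capRgCornerDataT.scaleLower ≤ Θ.mismatch * Λ :=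
    mul_le_mul_of_nonneg_left hΛ.1 (by exact_mod_cast Θ.mismatch_pos.le)
  -- the rational enclosure, chosen outside the thermodynamic block, and the precision handed to the engine
  obtain ⟨a, b, ha, hab, hb, hw, hax, hxb⟩ := exists_window_of_mem_Ioo hlo hhi Θ.width_pos
  have hη : 0 < min (lam - a) (b - lam) := lt_min (by linarith) (by linarith)
  have hwin := hcert _ hη
  have ha_pos : (0 : ℝ) < a := by
    have h18 : ((symmetricWindowLower : ℚ) : ℝ) ≤ a := by exact_mod_cast ha
    have : ((symmetricWindowLower : ℚ) : ℝ) = 1 / 8 := by norm_num [symmetricWindowLower]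
    linarith
  have hthr_pos : 0 < lam - min (lam - a) (b - lam) := by
    have := min_le_left (lam - a) (b - lam); linarith
  refine ⟨K, Λ, ?_⟩
  -- pointwise, strict margins + the certified Cooper channel ⇒ the seven clauses, eventually in `(L, β, M)`
  have hev : ∀ᶠ L : ℕ in atTop, ∀ᶠ β : ℝ in atTop, ∀ᶠ M : ℕ in atTop,
      SymmetricCertifiedAtT capRgCornerDataT Θ a b Λ (L + 1) (M + 1) β (nambuXiCT (L + 1) μ K)
        (hubbardEffectiveActionCT (L + 1) (M + 1) β U μ 0 K Λ) (hubbardEffPartitionFnCT (L + 1) (M + 1) β U μ 0 K Λ) := by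
    refine (hmis.and (hwin.and hblock)).mono fun L hL => ?_
    refine (hL.1.and (hL.2.1.and hL.2.2)).mono fun β hβ => ?_
    refine (hβ.1.and (hβ.2.1.and hβ.2.2)).mono fun M hM => ?_
    obtain ⟨hmis', ⟨N, cert, hchk⟩, hZ, hz, h4, hrem, hst⟩ := hM
    obtain ⟨hdom, hlam_a', hlam_b'⟩ :=
      cooper_of_cert hthr_pos (fun γ k k' => stub_cooperC4v (L + 1) (M + 1) β U μ Λ K γ k k') cert hchk
    have hlam_a : (a : ℝ) ≤ pairingStrength (L + 1) (M + 1) β (nambuXiCT (L + 1) μ K) Λ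
        (hubbardEffectiveActionCT (L + 1) (M + 1) β U μ 0 K Λ) := by
      have := min_le_left (lam - a) (b - lam)
      unfold pairingStrength; linarith
    have hlam_b : pairingStrength (L + 1) (M + 1) β (nambuXiCT (L + 1) μ K) Λ
        (hubbardEffectiveActionCT (L + 1) (M + 1) β U μ 0 K Λ) ≤ b := by
      have := min_le_right (lam - a) (b - lam)
      unfold pairingStrength; linarith
    refine ⟨hZ, fun k hk σ => ?_, fun k hk σ => ⟨(hz k hk σ).1.le, (hz k hk σ).2.le⟩, h4.le, hrem.le,
      ⟨hdom, fun q => ⟨(hst q).1.le, (hst q).2.le⟩⟩, hlam_a, hlam_b⟩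
    exact ((hmis' k hk σ).trans_le (by linarith)).le
  obtain ⟨L₀, hL₀⟩ := block_of_eventually
    (P := fun L _ β M _ => SymmetricCertifiedAtT capRgCornerDataT Θ a b Λ L M β (nambuXiCT L μ K)
      (hubbardEffectiveActionCT L M β U μ 0 K Λ) (hubbardEffPartitionFnCT L M β U μ 0 K Λ)) hev
  exact ⟨L₀, hframe, hΛ, hgeom, a, b, ha, hab, hb, hw, hL₀⟩

end Summit.HubbardSuperconductivity.CapRgSymmetricCertificatePinned.Loewner
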